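import Summits.KontsevichZagierPeriods.KontsevichZagierPeriods.Theses.MultivaluedCoV
import Summits.KontsevichZagierPeriods.KontsevichZagierPeriods.Theorems.HurwitzMicroSectorsNormalFormPrincipleSplitGlue

/-!
# Route MultivaluedCoV — the deciding crux `MultiCoVKernel` (stmt-KontsevichZagierPeriods-2873)
# split along `[π]`: `AyoubPiLocalKernel → AyoubPiCancellation → MultiCoVKernel`

Crux-strategist file (unit `cstrat-stmt-KontsevichZagierPeriods-2873-r1`, RESTATED re-audit of route
`route-KontsevichZagierPeriods-MultivaluedCoV`). The deciding crux

  `MultiCoVKernel : ∀ c, KZ.eval c = 0 → c ∈ closure ((1a) ∪ (1b) ∪ (3) ∪ multivalued-CoV relators)`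

is the kernel conjecture of the ENLARGED calculus KZ⁺; rule (2) is its one-sheet relator, so
`KZ.relations ≤ closure (KZ⁺ generators)` (`relations_le_plusClosure` below) and the summit's kernel
form implies it; conversely it implies the summit modulo the engine `SheetTransfer` (the route's
`closes`). Hence it is summit-equivalent (modulo a theorem-type item) and counts as a reduction only
through a typed decomposition. The decomposition filed here is the `[π]`-LOCALISATION CUT of the tree
(Kontsevich–Zagier 2001 §4.1 `P̂ = P[(2πi)⁻¹]`; Ayoub 2014 Def. 6 / Conj. 7; Huber–Wüstholz 2022
App. A.4), with BOTH children the existing shared items, verbatim: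

* child 1 `PiLocalKernel`  = body of stmt-KontsevichZagierPeriods-0541 (`AyoubPiLocalKernel`): for every
  pinned product `P n r = [π] ⋆ r` every value-zero formal combination becomes a KZ relation after
  finitely many `P`-multiplications — Conjecture 1 for the period ring LOCALISED at `[π]`, the half
  reachable by torsor / motivic arguments; carries all the transcendence content;
* child 2 `PiCancellation` = body of stmt-KontsevichZagierPeriods-0540 (`AyoubPiCancellation`):
  `P`-multiplication reflects relations (`[π]` is a non-zero-divisor on `FormalRep ⧸ relations`) —
  transcendence-free, its motivic shadow (effective → localised injectivity) printed OPEN.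

Proved here, sorry-free:
* `changeOfVariablesRel_subset_multiCoVRel` — rule (2) of the calculus IS the one-sheet (`N = 1`,
  `σ₀ = r.domain`) multivalued change of variables (the ten side conditions checked one by one);
* `relations_le_plusClosure` — hence every KZ relation is a KZ⁺ relation;
* `multiCoVKernel_of_kzKernelConjecture` — record of the direction summit ⇒ crux;
* `MultiCoVKernel_of_subs : PiLocalKernel → PiCancellation → MultiCoVKernel` — THE GLUE: a pinned
  product exists (`exists_pinnedProduct`, landed, so no `∀ P`-hypothesis is consumed vacuously); for
  `c ∈ ker eval` child 1 gives `(P⋆)^[N] c ∈ KZ.relations`, child 2 peels the `N` factors (induction on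
  `N`), and `relations_le_plusClosure` moves the result into the KZ⁺ closure.

After `route edit --split MultiCoVKernel --into {AyoubPiLocalKernel, AyoubPiCancellation}` the gate's glue
item `AyoubPiLocalKernel → AyoubPiCancellation → MultiCoVKernel` is this theorem after `unfold`
(bodies byte-identical with items 0541 / 0540).
-/

noncomputable section

namespace Summit.KontsevichZagierPeriods.MultivaluedCoV.MultiCoVKernelSplit

open Set MeasureTheory
open Literature.NumberTheory.Transcendental
open Summit.KontsevichZagierPeriods.KontsevichZagierPeriods.Theses.MultivaluedCoV (MultiCoVKernel SheetTransfer)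

/-! ## The two children (verbatim bodies of items 0541 / 0540) -/

/-- **Child 1 = item stmt-KontsevichZagierPeriods-0541 (`AyoubPiLocalKernel`), verbatim body.**
`π`-local kernel: for every pinned product `P` (`P n r` has domain `{z | z₀²+z₁² ≤ 1 ∧ (z₂,…) ∈ r.domain}`
and integrand `z ↦ r.integrand (z₂,…)`), every formal combination of value `0` satisfies
`(lift (of ∘ P))^[N] c ∈ KZ.relations` for some `N`. [cite: Ayoub2014, Def. 6 and Conj. 7] -/
def PiLocalKernel : Prop :=
  ∀ (P : ∀ n : ℕ, Literature.NumberTheory.Transcendental.KZ.IntegralRep n → Literature.NumberTheory.Transcendental.KZ.IntegralRep (n + 2)), (∀ (n : ℕ) (r : Literature.NumberTheory.Transcendental.KZ.IntegralRep n), (P n r).domain = {z : Fin (n + 2) → ℝ | z 0 ^ 2 + z 1 ^ 2 ≤ 1 ∧ (fun i : Fin n => z i.succ.succ) ∈ r.domain} ∧ (P n r).integrand = fun z => r.integrand (fun i : Fin n => z i.succ.succ)) → ∀ c : Literature.NumberTheory.Transcendental.KZ.FormalRep, Literature.NumberTheory.Transcendental.KZ.eval c = 0 → ∃ N : ℕ,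 (⇑(FreeAbelianGroup.lift (fun s : (Σ n, Literature.NumberTheory.Transcendental.KZ.IntegralRep n) => Literature.NumberTheory.Transcendental.KZ.of (P s.1 s.2))))^[N] c ∈ Literature.NumberTheory.Transcendental.KZ.relations

/-- **Child 2 = item stmt-KontsevichZagierPeriods-0540 (`AyoubPiCancellation`), verbatim body.**
`π`-cancellation: for every pinned product `P`, `lift (of ∘ P) c ∈ KZ.relations → c ∈ KZ.relations`.
[cite: HuberWustholz2022, App. A.4] -/
def PiCancellation : Prop :=
  ∀ (P : ∀ n : ℕ, Literature.NumberTheory.Transcendental.KZ.IntegralRep n → Literature.NumberTheory.Transcendental.KZ.IntegralRep (n + 2)), (∀ (n : ℕ) (r : Literature.NumberTheory.Transcendental.KZ.IntegralRep n), (P n r).domain = {z : Fin (n + 2) → ℝ | z 0 ^ 2 + z 1 ^ 2 ≤ 1 ∧ (fun i : Fin n => z i.succ.succ) ∈ r.domain} ∧ (P n r).integrand = fun z => r.integrand (fun i : Fin n => z i.succ.succ)) → ∀ c : Literature.NumberTheory.Transcendental.KZ.FormalRep, FreeAbelianGroup.lift (fun s : (Σ n, Literature.NumberTheory.Transcendental.KZ.IntegralRep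 n) => Literature.NumberTheory.Transcendental.KZ.of (P s.1 s.2)) c ∈ Literature.NumberTheory.Transcendental.KZ.relations → c ∈ Literature.NumberTheory.Transcendental.KZ.relations

/-! ## KZ⁺: the enlarged generator set -/

/-- The multivalued change-of-variables relators `[σ, Σ_k 1_{σ_k}·(g ∘ Φ_k)·|det Φ_k'|] − N·[τ, g]`
(the fourth generator set inside `MultiCoVKernel`, copied verbatim). [cite: KontsevichZagier2001, §1.2 rule (2)] -/
def multiCoVRel : Set KZ.FormalRep :=
  {c | ∃ (n N : ℕ) (r r' : Literature.NumberTheory.Transcendental.KZ.IntegralRep n) (σ : Fin N → Set (Fin n → ℝ)) (Φ : Fin N → (Fin n → ℝ) → (Fin n → ℝ)) (Φ' : Fin N → (Fin n → ℝ) → ((Fin n → ℝ) →L[ℝ] (Fin n → ℝ))), (∀ k, Literature.ModelTheory.ExponentialFields.IsSemialgebraic ℚ (σ k)) ∧ (∀ k, σ k ⊆ r.domain) ∧ MeasureTheory.volume (r.domain \ ⋃ k, σ k) = 0 ∧ (∀ k, Literature.NumberTheory.Transcendental.IsSemialgebraicMapOn ℚ (σ k) (Φ k)) ∧ (∀ k,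 ∀ x ∈ σ k, HasFDerivWithinAt (Φ k) (Φ' k x) (σ k) x) ∧ (∀ k, Set.InjOn (Φ k) (σ k)) ∧ (∀ k, Φ k '' σ k ⊆ r'.domain) ∧ (∀ k, MeasureTheory.volume (r'.domain \ Φ k '' σ k) = 0) ∧ (∀ x ∈ ⋃ k, σ k, r.integrand x = ∑ k : Fin N, (σ k).indicator (fun y => r'.integrand (Φ k y) * |(Φ' k y).det|) x) ∧ c = Literature.NumberTheory.Transcendental.KZ.of r - N • Literature.NumberTheory.Transcendental.KZ.of r'}

/-- The relations of the enlarged calculus KZ⁺: generated by (1a), (1b), (3) and the multivalued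
change-of-variables relators. [cite: KontsevichZagier2001, §1.2] -/
def plusClosure : AddSubgroup KZ.FormalRep :=
  AddSubgroup.closure (KZ.domainAddRel ∪ KZ.integrandAddRel ∪ KZ.newtonLeibnizRel ∪ multiCoVRel)

/-- `MultiCoVKernel` is literally `ker eval ≤ plusClosure`. [folklore] -/
theorem multiCoVKernel_iff : MultiCoVKernel ↔ ∀ c : KZ.FormalRep, KZ.eval c = 0 → c ∈ plusClosure :=
  Iff.rfl

/-- **Rule (2) is the one-sheet multivalued change of variables.** A `changeOfVariablesRel` instance
`(r, r', Φ, Φ')` is the relator with `N = 1`, the single sheet `σ₀ = r.domain` and the map `Φ`: the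
sheet is `ℚ`-semialgebraic and exhausts the domain, `Φ` is semialgebraic, differentiable within the
sheet and injective on it, its image is exactly `r'.domain` (so co-null there), the integrand identity
is `f x = f' (Φ x)·|det Φ' x|` on the sheet, and `[r] − 1 • [r'] = [r] − [r']`.
[cite: KontsevichZagier2001, §1.2 rule (2)] -/
theorem changeOfVariablesRel_subset_multiCoVRel : KZ.changeOfVariablesRel ⊆ multiCoVRel := by
  rintro c ⟨n, r, r', Φ, Φ', hsa, hder, hinj, hdom, hf, rfl⟩
  refine ⟨n, 1, r, r', fun _ => r.domain, fun _ => Φ, fun _ => Φ', ?_, ?_, ?_, ?_, ?_, ?_, ?_, ?_, ?_, ?_⟩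
  · intro _; exact r.isSemialgebraic_domain
  · intro _; exact Subset.rfl
  · simp [Set.iUnion_const]
  · intro _; exact hsa
  · intro _ x hx; exact hder x hx
  · intro _; exact hinj
  · intro _; rw [hdom]
  · intro _; simp [hdom]
  · intro x hx
    have hx' : x ∈ r.domain := by simpa [Set.iUnion_const] using hx
    simp [Set.indicator_of_mem hx', hf x hx']
  · simp

/-- **Every KZ relation is a KZ⁺ relation**: (1a), (1b), (3) are generators of both, and rule (2) is
the one-sheet relator (`changeOfVariablesRel_subset_multiCoVRel`). [cite: KontsevichZagier2001, §1.2] -/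
theorem relations_le_plusClosure : KZ.relations ≤ plusClosure := by
  refine (AddSubgroup.closure_le _).mpr ?_
  rintro c (((hc | hc) | hc) | hc)
  · exact AddSubgroup.subset_closure (Or.inl (Or.inl (Or.inl hc)))
  · exact AddSubgroup.subset_closure (Or.inl (Or.inl (Or.inr hc)))
  · exact AddSubgroup.subset_closure (Or.inr (changeOfVariablesRel_subset_multiCoVRel hc))
  · exact AddSubgroup.subset_closure (Or.inl (Or.inr hc))

/-- Record of the direction summit ⇒ crux: the kernel form of Conjecture 1
(`KZKernelConjecture`, summit-equivalent by `kzKernelConjecture_iff_isRational`) implies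
`MultiCoVKernel`. [folklore] -/
theorem multiCoVKernel_of_kzKernelConjecture (h : KZKernelConjecture) : MultiCoVKernel :=
  fun c hc => relations_le_plusClosure (h c hc)

/-! ## The glue -/

/-- **GLUE of the split `MultiCoVKernel ⟸ AyoubPiLocalKernel ∧ AyoubPiCancellation`.** A pinned product
`P` exists (`exists_pinnedProduct`, Theorems/HurwitzMicroSectorsNormalFormPrincipleSplitGlue: domain
`disc × σ` semialgebraic, integrand a coordinate preimage, integrability by Tonelli), so neither
`∀ P`-hypothesis is consumed vacuously. For `c` with `KZ.eval c = 0`, the `π`-local kernel gives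
`N` with `(lift (of ∘ P))^[N] c ∈ KZ.relations`; `π`-cancellation removes the factors one at a time
(induction on `N`, left-nested iterates `Function.iterate_succ_apply'`), so `c ∈ KZ.relations`; and
every KZ relation is a KZ⁺ relation (`relations_le_plusClosure`: rule (2) is the one-sheet
multivalued change of variables). [cite: Ayoub2014, Def. 6 and Conj. 7] -/
theorem MultiCoVKernel_of_subs (h₁ : PiLocalKernel) (h₂ : PiCancellation) : MultiCoVKernel := by
  -- a pinned product `[π] ⋆ ·` exists
  obtain ⟨P, hP⟩ :=
    Summit.KontsevichZagierPeriods.HurwitzMicroSectors.NormalFormPrincipleSplitGlue.exists_pinnedProduct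
  intro c hc
  -- child 1: some `[π]^N ⋆ c` is a KZ relation
  obtain ⟨N, hN⟩ := h₁ P hP c hc
  -- child 2 peels the `N` factors `[π]`
  have hrel : c ∈ KZ.relations := by
    clear hc
    induction N with
    | zero => simpa using hN
    | succ N ih =>
      exact ih (h₂ P hP _ (by simpa only [Function.iterate_succ_apply'] using hN))
  -- KZ relations are KZ⁺ relations
  exact relations_le_plusClosure hrel

/-- The same glue with the crux unfolded to `ker eval ≤ plusClosure` (shape used by the probes). [folklore] -/
theorem ker_eval_le_plusClosure_of_subs (h₁ : PiLocalKernel) (h₂ : PiCancellation) :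
    ∀ c : KZ.FormalRep, KZ.eval c = 0 → c ∈ plusClosure :=
  multiCoVKernel_iff.mp (MultiCoVKernel_of_subs h₁ h₂)

end Summit.KontsevichZagierPeriods.MultivaluedCoV.MultiCoVKernelSplit

end
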